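import Summits.KontsevichZagierPeriods.KontsevichZagierPeriods.Theses.TorsionLogs
import Summits.KontsevichZagierPeriods.KontsevichZagierPeriods.Theorems.TorsionLogsNeronTorsionSector
import Summits.KontsevichZagierPeriods.KontsevichZagierPeriods.Theorems.TorsionLogsTorsionSectorCompleteReductions
import Literature.NumberTheory.Transcendental.KZKernelConjectureForms

/-!
# Crux `TorsionSectorComplete` (stmt-KontsevichZagierPeriods-14212) — line `NeronDistribution`
# (forward generator G1 `next-rung` over the floor `NeronTorsionPrimitiveChain`, unit fwd2-rung-KontsevichZagierPeriods-01-g5)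

FLOOR (seed g1-KontsevichZagierPeriods-17981, PROVED):
`Summit.KontsevichZagierPeriods.KontsevichZagierPeriods.Cruxes.NeronTorsionSector.Translation.stub_assembly`
— the primitive Néron–torsion chain `q²[rI_P] + p²[rP] − c[rB] ∈ KZ.relations` at a real `N`-torsion point `P`
of the identity component, built on the torsion translation GRID `x_k = X(kω₁/n)`.

RUNG `NeronDistribution := ∀ regular : Bool, NeronDistributionMember regular` (this file; items F1–F4 of the
forward pipeline in the docstrings).  ONE hypothesis of the floor is generalised: the lower corner of the grid —
the 2-torsion point `T = (e₁,0) = (N/2)·P` of a TORSION point — becomes `Q = n • P` (Mathlib's group law,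
`n ≥ 2`) for an ARBITRARY real algebraic point `P` of the identity component, torsion or not; the element becomes
the tied `[n]`-DISTRIBUTION element `4[rI_Q] − 4n²[rI_P] + 2μ[rR_Q] − μ²[rP]` with `μ = 1 − εn − 2k` read off the
sheet datum `∫_{x_Q}^∞ dx/√f = εn∫_{x_P}^∞ dx/√f + 2k∫_{e₁}^∞ dx/√f` (value, by the distribution relation /
quasi-parallelogram law of the archimedean Néron function, `λ(nP) = n²λ(P) + log|ψ_n(P)| + const`:
`((n²−1)/2)·log|ψ₃(e₁)| − 4·log|ψ_n(x_P, y_P)| ∈ ℚ-span of logs of algebraic numbers`; numerically verified to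
`5·10⁻¹⁴` on nine non-torsion instances, `compute/dist_check.py` of the filing seat).
* member `false` (`x_Q = e₁`, i.e. `Q = T`, `P` of even order): PROVED below from the floor (it is the floor's
  element times `−g²`, `2n = gq`, `μ = ∓gp`) — `neronDistributionMember_false`; F3 witness file
  `Lines/NeronDistribution_special.lean`;
* member `true` (`e₁ < x_Q`): NON-torsion `P` allowed — outside every torsion sector; from the two registered
  stubs (`neronDistributionMember_true_of`);
* on-path (F4): `KontsevichZagierPeriods → NeronDistribution` PROVED (`neronDistribution_of_kontsevichZagierPeriods`,
  also `Lines/NeronDistribution_onpath.lean`): kernel form of Conjecture 1 + the value hypothesis;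
* the crux BY NAME: `TorsionSectorComplete_of` from the three stubs (rung ⇒ `closure DistributionTied ≤ relations`,
  so the residual's enlarged sector collapses to the torsion sector).

WHY THE FLOOR'S PROOF STOPS (located failure): `TorsionLogsNeronTorsionSectorStubGridData.lean` builds the finite
grid `x_k = X(kω₁/n)` through `x_P` (`hNma : 2N(m − aa) = n(N − 2a)`); translation by a NON-torsion `P` has infinite
order, so no finite algebraic grid contains `x_P` and the translation-cocycle telescoping
(`StubTranslationCalculus`, `AssemblyXFold`, `stub_periodSymmetry`) has nothing to sum over.
REPLACEMENT (technique menu: change of variables by a finite algebraic correspondence + exact second-kind cocycle):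
the `[n]`-SHEET TRANSFER `x ↦ X_n(x) = Φ_n(x)/ψ_n(x)²` on the `n` sheets of `(e₁, ∞)` cut at the `2n`-torsion
abscissae, with `[n]^*(dx/y) = n·dx/y` and the regularised second-kind cocycle `[n]^*(h dx/y) = n·h dx/y + dW̃_n`,
`h = (g₂x + 2g₃)/(4x²)`, `W̃_n dx/y`-primitive `(1/2n)·dlog(Φ_n(x)/x^{n²})` (stub 1), plus the complete regularised
triangle `4[H_∞] − [rP] ≡ log` by a shuffle and ONE 2-torsion translation (stub 2, floor technology).
-/

open Set MeasureTheory
open Literature.NumberTheory.Transcendental Literature.ModelTheory.ExponentialFields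
open Summit.KontsevichZagierPeriods.KontsevichZagierPeriods.Theses.TorsionLogs (TorsionSectorComplete)
open Summit.KontsevichZagierPeriods.HyperbolicBloch.OffTetraSectorKernel (interval_log_relation_mem_relations)
open Summit.KontsevichZagierPeriods.KontsevichZagierPeriods.Cruxes.NeronTorsionSector.Translation
  (stub_assembly stub_realDictionary logRep_value isAlgebraic_endpoints_of_isSemialgebraic_Ioo)

namespace Summit.KontsevichZagierPeriods.KontsevichZagierPeriods.Cruxes.TorsionSectorComplete.NeronDistribution

/-! ### The rung (F1) -/

/-- MEMBER `regular` of the `[n]`-distribution rung (tied form). Data: the floor's curve/point/order data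
verbatim (`N = addOrderOf P`, `N = 0` for non-torsion `P`, with the floor's torsion parameter `a`), the
multiplier `n ≥ 2`, the point `Q = n • P = (x_Q, y_Q)` (`regular = false`: `x_Q = e₁`; `regular = true`:
`e₁ < x_Q`), the sheet datum `(ε, k)` and `μ = 1 − εn − 2k`, the representations `rI_P, rI_Q` (length-two
triangles), `rR_Q` (first-kind interval ⊗ `η₁`-carrier), `rP` (`ω₁ ⊗ η₁`), one logarithmic carrier `rB`, and the
value hypothesis tying `c`. Conclusion: the tied distribution element is a relation of the KZ move calculus. -/
def NeronDistributionMember (regular : Bool) : Prop :=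
  ∀ (g₂ g₃ e₁ xP yP xQ yQ B : ℝ) (N a n : ℕ) (ε k μ c : ℤ) (f : ℝ → ℝ),
    (∀ x, f x = 4 * x ^ 3 - g₂ * x - g₃) → g₂ ^ 3 - 27 * g₃ ^ 2 ≠ 0 → f e₁ = 0 → 0 < e₁ →
    (∀ x, e₁ < x → 0 < f x) → e₁ < xP → yP ^ 2 = f xP →
    (∀ hns : (⟨0, 0, 0, -g₂ / 4, -g₃ / 4⟩ : WeierstrassCurve ℝ).toAffine.Nonsingular xP (yP / 2),
      addOrderOf (WeierstrassCurve.Affine.Point.some xP (yP / 2) hns) = N) →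
    (N : ℝ) * (∫ x in Set.Ioi xP, (Real.sqrt (f x))⁻¹) = a * (2 * ∫ x in Set.Ioi e₁, (Real.sqrt (f x))⁻¹) →
    2 ≤ n → (if regular then e₁ < xQ else xQ = e₁) → yQ ^ 2 = f xQ →
    (∀ (hnsP : (⟨0, 0, 0, -g₂ / 4, -g₃ / 4⟩ : WeierstrassCurve ℝ).toAffine.Nonsingular xP (yP / 2))
       (hnsQ : (⟨0, 0, 0, -g₂ / 4, -g₃ / 4⟩ : WeierstrassCurve ℝ).toAffine.Nonsingular xQ (yQ / 2)),
      n • WeierstrassCurve.Affine.Point.some xP (yP / 2) hnsP =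
        WeierstrassCurve.Affine.Point.some xQ (yQ / 2) hnsQ) →
    (ε = 1 ∨ ε = -1) →
    (∫ x in Set.Ioi xQ, (Real.sqrt (f x))⁻¹) =
      ε * n * (∫ x in Set.Ioi xP, (Real.sqrt (f x))⁻¹) + k * (2 * ∫ x in Set.Ioi e₁, (Real.sqrt (f x))⁻¹) →
    μ = 1 - ε * n - 2 * k →
    ∀ (rIP rIQ rRQ rP : Literature.NumberTheory.Transcendental.KZ.IntegralRep 2)
      (rB : Literature.NumberTheory.Transcendental.KZ.IntegralRep 1),
    rIP.domain = {z | e₁ < z 1 ∧ z 1 < z 0 ∧ z 0 < xP} →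
    Set.EqOn rIP.integrand (fun z => z 1 / (Real.sqrt (f (z 1)) * Real.sqrt (f (z 0)))) rIP.domain →
    rIQ.domain = {z | e₁ < z 1 ∧ z 1 < z 0 ∧ z 0 < xQ} →
    Set.EqOn rIQ.integrand (fun z => z 1 / (Real.sqrt (f (z 1)) * Real.sqrt (f (z 0)))) rIQ.domain →
    rRQ.domain = {z | e₁ < z 0 ∧ z 0 < xQ ∧ e₁ < z 1} →
    Set.EqOn rRQ.integrand
      (fun z => (Real.sqrt (f (z 0)))⁻¹ * ((g₂ * z 1 + 2 * g₃) / (2 * (z 1) ^ 2 * Real.sqrt (f (z 1))))) rRQ.domain →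
    rP.domain = {z | e₁ < z 0 ∧ e₁ < z 1} →
    Set.EqOn rP.integrand
      (fun z => (Real.sqrt (f (z 0)))⁻¹ * ((g₂ * z 1 + 2 * g₃) / (2 * (z 1) ^ 2 * Real.sqrt (f (z 1))))) rP.domain →
    1 < B → rB.domain = {t | 1 < t 0 ∧ t 0 < B} → Set.EqOn rB.integrand (fun t => (t 0)⁻¹) rB.domain →
    4 * rIQ.value - 4 * (n : ℝ) ^ 2 * rIP.value + 2 * (μ : ℝ) * rRQ.value - (μ : ℝ) ^ 2 * rP.value = c * rB.value →
    (4 : ℤ) • Literature.NumberTheory.Transcendental.KZ.of rIQ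
      - ((4 * n ^ 2 : ℕ) : ℤ) • Literature.NumberTheory.Transcendental.KZ.of rIP
      + (2 * μ) • Literature.NumberTheory.Transcendental.KZ.of rRQ
      - (μ ^ 2) • Literature.NumberTheory.Transcendental.KZ.of rP
      - c • Literature.NumberTheory.Transcendental.KZ.of rB ∈ Literature.NumberTheory.Transcendental.KZ.relations

/-- THE RUNG: both members. -/
def NeronDistribution : Prop := ∀ regular : Bool, NeronDistributionMember regular

/-- STUB 1 statement (the new move — `[n]`-SHEET TRANSFER with the regularised second-kind cocycle; regular member).
For `e₁ < x_Q` the h-regularised distribution element, corrected by `4(n²−1)` complete regularised triangles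
`[H_∞]` (`H_∞ = ∬_{e₁<x'<x} h(x')dx'dx/(√f(x')√f(x))`, `h = (g₂x+2g₃)/(4x²)`), is an integer multiple of ONE
logarithmic carrier modulo the moves:
`4[rI_Q] − 4n²[rI_P] + 2μ[rR_Q] − (μ²−n²+1)[rP] − 4(n²−1)[H_∞] − c₁[1<t<B₁, dt/t] ∈ relations`
(expected value `−4 log|ψ_n(P)| + 2(n²−1) log e₁`; mechanism: change of variables by the monotone branches of
`x ↦ X_n(x) = Φ_n(x)/ψ_n(x)²` on the `n` sheets of `(e₁,∞)` cut at the `2n`-torsion abscissae, the cocycle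
`[n]^*(h dx/y) = n·h dx/y + d W̃_n`, `W̃_n dx/y`-primitive `(1/2n) dlog(Φ_n(x)/x^{n²})`, fibrewise Newton–Leibniz,
dlog unfolding; inner regularisation by the landed `stub_rIReduction`). -/
def SheetTransfer : Prop :=
  ∀ (g₂ g₃ e₁ xP yP xQ yQ : ℝ) (n : ℕ) (ε k μ : ℤ) (f : ℝ → ℝ),
    (∀ x, f x = 4 * x ^ 3 - g₂ * x - g₃) → g₂ ^ 3 - 27 * g₃ ^ 2 ≠ 0 → f e₁ = 0 → 0 < e₁ →
    (∀ x, e₁ < x → 0 < f x) → e₁ < xP → yP ^ 2 = f xP → 2 ≤ n → e₁ < xQ → yQ ^ 2 = f xQ →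
    (∀ (hnsP : (⟨0, 0, 0, -g₂ / 4, -g₃ / 4⟩ : WeierstrassCurve ℝ).toAffine.Nonsingular xP (yP / 2))
       (hnsQ : (⟨0, 0, 0, -g₂ / 4, -g₃ / 4⟩ : WeierstrassCurve ℝ).toAffine.Nonsingular xQ (yQ / 2)),
      n • WeierstrassCurve.Affine.Point.some xP (yP / 2) hnsP =
        WeierstrassCurve.Affine.Point.some xQ (yQ / 2) hnsQ) →
    (ε = 1 ∨ ε = -1) →
    (∫ x in Set.Ioi xQ, (Real.sqrt (f x))⁻¹) =
      ε * n * (∫ x in Set.Ioi xP, (Real.sqrt (f x))⁻¹) + k * (2 * ∫ x in Set.Ioi e₁, (Real.sqrt (f x))⁻¹) →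
    μ = 1 - ε * n - 2 * k →
    ∀ (rIP rIQ rRQ rP Hinf : Literature.NumberTheory.Transcendental.KZ.IntegralRep 2),
    rIP.domain = {z | e₁ < z 1 ∧ z 1 < z 0 ∧ z 0 < xP} →
    Set.EqOn rIP.integrand (fun z => z 1 / (Real.sqrt (f (z 1)) * Real.sqrt (f (z 0)))) rIP.domain →
    rIQ.domain = {z | e₁ < z 1 ∧ z 1 < z 0 ∧ z 0 < xQ} →
    Set.EqOn rIQ.integrand (fun z => z 1 / (Real.sqrt (f (z 1)) * Real.sqrt (f (z 0)))) rIQ.domain →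
    rRQ.domain = {z | e₁ < z 0 ∧ z 0 < xQ ∧ e₁ < z 1} →
    Set.EqOn rRQ.integrand
      (fun z => (Real.sqrt (f (z 0)))⁻¹ * ((g₂ * z 1 + 2 * g₃) / (2 * (z 1) ^ 2 * Real.sqrt (f (z 1))))) rRQ.domain →
    rP.domain = {z | e₁ < z 0 ∧ e₁ < z 1} →
    Set.EqOn rP.integrand
      (fun z => (Real.sqrt (f (z 0)))⁻¹ * ((g₂ * z 1 + 2 * g₃) / (2 * (z 1) ^ 2 * Real.sqrt (f (z 1))))) rP.domain →
    Hinf.domain = {z | e₁ < z 1 ∧ z 1 < z 0} →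
    Set.EqOn Hinf.integrand
      (fun z => (g₂ * z 1 + 2 * g₃) / (4 * (z 1) ^ 2) / (Real.sqrt (f (z 0)) * Real.sqrt (f (z 1)))) Hinf.domain →
    ∃ (c₁ : ℤ) (B₁ : ℝ) (rB₁ : Literature.NumberTheory.Transcendental.KZ.IntegralRep 1),
      1 < B₁ ∧ IsAlgebraic ℚ B₁ ∧ rB₁.domain = {t | 1 < t 0 ∧ t 0 < B₁} ∧
      Set.EqOn rB₁.integrand (fun t => (t 0)⁻¹) rB₁.domain ∧
      (4 : ℤ) • Literature.NumberTheory.Transcendental.KZ.of rIQ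
        - ((4 * n ^ 2 : ℕ) : ℤ) • Literature.NumberTheory.Transcendental.KZ.of rIP
        + (2 * μ) • Literature.NumberTheory.Transcendental.KZ.of rRQ
        - (μ ^ 2 - n ^ 2 + 1) • Literature.NumberTheory.Transcendental.KZ.of rP
        - (4 * ((n : ℤ) ^ 2 - 1)) • Literature.NumberTheory.Transcendental.KZ.of Hinf
        - c₁ • Literature.NumberTheory.Transcendental.KZ.of rB₁ ∈ Literature.NumberTheory.Transcendental.KZ.relations

/-- STUB 2 statement (COMPLETE REGULARISED TRIANGLE): the complete h-triangle `H_∞` exists as an absolutely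
convergent representation and `4[H_∞] − [rP]` is an integer multiple of one logarithmic carrier modulo the moves
(expected value `½ log(|ψ₃(e₁)|/e₁⁴)`, `ψ₃ = 3x⁴ − (3/2)g₂x² − 3g₃x − g₂²/16`; mechanism: shuffle
`[H_∞] + [H_∞ᵗ] = ½[rP]` (Fubini + domain additivity) and ONE transfer by the 2-torsion translation `τ_T`
(the floor's translation cocycle, `StubTranslationCalculus`), then dlog unfolding). -/
def CompleteTriangle : Prop :=
  ∀ (g₂ g₃ e₁ : ℝ) (f : ℝ → ℝ),
    (∀ x, f x = 4 * x ^ 3 - g₂ * x - g₃) → g₂ ^ 3 - 27 * g₃ ^ 2 ≠ 0 → f e₁ = 0 → 0 < e₁ →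
    (∀ x, e₁ < x → 0 < f x) →
    ∀ (rP : Literature.NumberTheory.Transcendental.KZ.IntegralRep 2),
    rP.domain = {z | e₁ < z 0 ∧ e₁ < z 1} →
    Set.EqOn rP.integrand
      (fun z => (Real.sqrt (f (z 0)))⁻¹ * ((g₂ * z 1 + 2 * g₃) / (2 * (z 1) ^ 2 * Real.sqrt (f (z 1))))) rP.domain →
    ∃ (Hinf : Literature.NumberTheory.Transcendental.KZ.IntegralRep 2) (c₂ : ℤ) (B₂ : ℝ)
      (rB₂ : Literature.NumberTheory.Transcendental.KZ.IntegralRep 1),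
      Hinf.domain = {z | e₁ < z 1 ∧ z 1 < z 0} ∧
      Set.EqOn Hinf.integrand
        (fun z => (g₂ * z 1 + 2 * g₃) / (4 * (z 1) ^ 2) / (Real.sqrt (f (z 0)) * Real.sqrt (f (z 1)))) Hinf.domain ∧
      1 < B₂ ∧ IsAlgebraic ℚ B₂ ∧ rB₂.domain = {t | 1 < t 0 ∧ t 0 < B₂} ∧
      Set.EqOn rB₂.integrand (fun t => (t 0)⁻¹) rB₂.domain ∧
      (4 : ℤ) • Literature.NumberTheory.Transcendental.KZ.of Hinf - Literature.NumberTheory.Transcendental.KZ.of rP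
        - c₂ • Literature.NumberTheory.Transcendental.KZ.of rB₂ ∈ Literature.NumberTheory.Transcendental.KZ.relations


/-! ### The residual -/

/-- The crux's own sector `T`: the tied Néron–torsion elements (the set inside `TorsionSectorComplete`, verbatim). -/
def TorsionTied : Set KZ.FormalRep :=
  {d : Literature.NumberTheory.Transcendental.KZ.FormalRep | ∃ (g₂ g₃ e₁ xP yP α : ℝ) (N a : ℕ) (M k m : ℤ) (f : ℝ → ℝ) (rI rP : Literature.NumberTheory.Transcendental.KZ.IntegralRep 2) (rL : Literature.NumberTheory.Transcendental.KZ.IntegralRep 1), (∀ x, f x = 4 * x ^ 3 - g₂ * x - g₃) ∧ g₂ ^ 3 - 27 * g₃ ^ 2 ≠ 0 ∧ f e₁ = 0 ∧ 0 < e₁ ∧ (∀ x, e₁ < x → 0 < f x) ∧ e₁ < xP ∧ yP ^ 2 = f xP ∧ 3 ≤ N ∧ 0 < a ∧ 2 * a < N ∧ 4 * (N : ℤ) ^ 2 * k = M * ((N : ℤ) - 2 * (a : ℤ)) ^ 2 ∧ (∀ hns : (⟨0, 0, 0, -g₂ / 4, -g₃ / 4⟩ : WeierstrassCurve ℝ).toAffine.Nonsingular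 xP (yP / 2), addOrderOf (WeierstrassCurve.Affine.Point.some xP (yP / 2) hns) = N) ∧ (N : ℝ) * (∫ x in Set.Ioi xP, (Real.sqrt (f x))⁻¹) = a * (2 * ∫ x in Set.Ioi e₁, (Real.sqrt (f x))⁻¹) ∧ 1 < α ∧ rI.domain = {z | e₁ < z 1 ∧ z 1 < z 0 ∧ z 0 < xP} ∧ Set.EqOn rI.integrand (fun z => z 1 / (Real.sqrt (f (z 1)) * Real.sqrt (f (z 0)))) rI.domain ∧ rP.domain = {z | e₁ < z 0 ∧ e₁ < z 1} ∧ Set.EqOn rP.integrand (fun z => (Real.sqrt (f (z 0)))⁻¹ * ((g₂ * z 1 + 2 * g₃) / (2 * (z 1) ^ 2 * Real.sqrt (f (z 1))))) rP.domain ∧ rL.domain = {t | 1 < t 0 ∧ t 0 < α} ∧ Set.EqOn rL.integrand (fun t => (t 0)⁻¹) rL.domain ∧ (M : ℝ) * rI.value + k * rP.value = m * rL.value ∧ d = M • Literature.NumberTheory.Transcendental.KZ.of rI + k • Literature.NumberTheory.Transcendental.KZ.of rP - m • Literature.NumberTheory.Transcendental.KZ.of rL}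

/-- Sanity: the crux is completeness modulo `relations ⊔ closure TorsionTied` (definitional). -/
theorem torsionSectorComplete_iff : TorsionSectorComplete ↔
    ∀ ⦃n m : ℕ⦄ (r : KZ.IntegralRep n) (r' : KZ.IntegralRep m), r.IsRational → r'.IsRational →
      r.value = r'.value → KZ.of r - KZ.of r' ∈ KZ.relations ⊔ AddSubgroup.closure TorsionTied :=
  Iff.rfl


/-- The tied `[n]`-distribution elements (both members), as a subset of the free abelian group `FormalRep`. -/
def DistributionTied : Set Literature.NumberTheory.Transcendental.KZ.FormalRep :=
  {d | ∃ (regular : Bool) (g₂ g₃ e₁ xP yP xQ yQ B : ℝ) (N a n : ℕ) (ε k μ c : ℤ) (f : ℝ → ℝ)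
      (rIP rIQ rRQ rP : Literature.NumberTheory.Transcendental.KZ.IntegralRep 2)
      (rB : Literature.NumberTheory.Transcendental.KZ.IntegralRep 1),
    (∀ x, f x = 4 * x ^ 3 - g₂ * x - g₃) ∧ g₂ ^ 3 - 27 * g₃ ^ 2 ≠ 0 ∧ f e₁ = 0 ∧ 0 < e₁ ∧
    (∀ x, e₁ < x → 0 < f x) ∧ e₁ < xP ∧ yP ^ 2 = f xP ∧
    (∀ hns : (⟨0, 0, 0, -g₂ / 4, -g₃ / 4⟩ : WeierstrassCurve ℝ).toAffine.Nonsingular xP (yP / 2),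
      addOrderOf (WeierstrassCurve.Affine.Point.some xP (yP / 2) hns) = N) ∧
    (N : ℝ) * (∫ x in Set.Ioi xP, (Real.sqrt (f x))⁻¹) = a * (2 * ∫ x in Set.Ioi e₁, (Real.sqrt (f x))⁻¹) ∧
    2 ≤ n ∧ (if regular then e₁ < xQ else xQ = e₁) ∧ yQ ^ 2 = f xQ ∧
    (∀ (hnsP : (⟨0, 0, 0, -g₂ / 4, -g₃ / 4⟩ : WeierstrassCurve ℝ).toAffine.Nonsingular xP (yP / 2))
       (hnsQ : (⟨0, 0, 0, -g₂ / 4, -g₃ / 4⟩ : WeierstrassCurve ℝ).toAffine.Nonsingular xQ (yQ / 2)),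
      n • WeierstrassCurve.Affine.Point.some xP (yP / 2) hnsP =
        WeierstrassCurve.Affine.Point.some xQ (yQ / 2) hnsQ) ∧
    (ε = 1 ∨ ε = -1) ∧
    (∫ x in Set.Ioi xQ, (Real.sqrt (f x))⁻¹) =
      ε * n * (∫ x in Set.Ioi xP, (Real.sqrt (f x))⁻¹) + k * (2 * ∫ x in Set.Ioi e₁, (Real.sqrt (f x))⁻¹) ∧
    μ = 1 - ε * n - 2 * k ∧
    rIP.domain = {z | e₁ < z 1 ∧ z 1 < z 0 ∧ z 0 < xP} ∧
    Set.EqOn rIP.integrand (fun z => z 1 / (Real.sqrt (f (z 1)) * Real.sqrt (f (z 0)))) rIP.domain ∧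
    rIQ.domain = {z | e₁ < z 1 ∧ z 1 < z 0 ∧ z 0 < xQ} ∧
    Set.EqOn rIQ.integrand (fun z => z 1 / (Real.sqrt (f (z 1)) * Real.sqrt (f (z 0)))) rIQ.domain ∧
    rRQ.domain = {z | e₁ < z 0 ∧ z 0 < xQ ∧ e₁ < z 1} ∧
    Set.EqOn rRQ.integrand
      (fun z => (Real.sqrt (f (z 0)))⁻¹ * ((g₂ * z 1 + 2 * g₃) / (2 * (z 1) ^ 2 * Real.sqrt (f (z 1))))) rRQ.domain ∧
    rP.domain = {z | e₁ < z 0 ∧ e₁ < z 1} ∧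
    Set.EqOn rP.integrand
      (fun z => (Real.sqrt (f (z 0)))⁻¹ * ((g₂ * z 1 + 2 * g₃) / (2 * (z 1) ^ 2 * Real.sqrt (f (z 1))))) rP.domain ∧
    1 < B ∧ rB.domain = {t | 1 < t 0 ∧ t 0 < B} ∧ Set.EqOn rB.integrand (fun t => (t 0)⁻¹) rB.domain ∧
    4 * rIQ.value - 4 * (n : ℝ) ^ 2 * rIP.value + 2 * (μ : ℝ) * rRQ.value - (μ : ℝ) ^ 2 * rP.value = c * rB.value ∧
    d = (4 : ℤ) • Literature.NumberTheory.Transcendental.KZ.of rIQ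
      - ((4 * n ^ 2 : ℕ) : ℤ) • Literature.NumberTheory.Transcendental.KZ.of rIP
      + (2 * μ) • Literature.NumberTheory.Transcendental.KZ.of rRQ
      - (μ ^ 2) • Literature.NumberTheory.Transcendental.KZ.of rP
      - c • Literature.NumberTheory.Transcendental.KZ.of rB}

/-- **RESIDUAL `DistributionSectorComplete`**: Conjecture 1 for rational pairs MODULO the torsion sector ENLARGED
by the tied distribution elements, `(relations ⊔ closure TorsionTied) ⊔ closure DistributionTied`.  Weaker than
the crux (monotonicity of `⊔`); conjecture-grade.  Its kill path: a rational pair separated from the enlarged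
sector (genus-2 regulator or a two-point bilinear pairing value, the rung after next). [cite: KontsevichZagier2001, §1.2] -/
def DistributionSectorComplete : Prop :=
  ∀ ⦃n m : ℕ⦄ (r : Literature.NumberTheory.Transcendental.KZ.IntegralRep n)
    (r' : Literature.NumberTheory.Transcendental.KZ.IntegralRep m), r.IsRational → r'.IsRational →
    r.value = r'.value →
    Literature.NumberTheory.Transcendental.KZ.of r - Literature.NumberTheory.Transcendental.KZ.of r' ∈
      (Literature.NumberTheory.Transcendental.KZ.relations ⊔ AddSubgroup.closure TorsionTied) ⊔
        AddSubgroup.closure DistributionTied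

/-! ### Registered stubs -/

/-- **Stub 1 (XL — the NEW move, load-bearing): the `[n]`-sheet transfer.**  Proof plan: (i) the algebraic
`[n]`-map `X_n = Φ_n/ΨSq_n` (Mathlib `WeierstrassCurve.Φ`, `ΨSq`) agrees with `u ↦ nu` through the real
dictionary (`stub_realDictionary`: chord/tangent formulae, induction on `n`), is strictly monotone on each of the
`n` sheets of `(e₁,∞)` cut at the `2n`-torsion abscissae (algebraic: preimages of `e₁`/poles of `X_n`), with
`√f(X_n(x))·n = |X_n'(x)|·√f(x)`; (ii) rule 2 on the 2-cells sheet × sheet, rule 1 to re-assemble the image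
triangles/rectangles (shuffle `[x'<x] + [x'>x] = [quadrant]`, periodicity/reflection are the identity on `x`);
(iii) the cocycle identity `2n·(h(X_n(x)) − h(x)) = f'(x)V_n(x) + 2f(x)V_n'(x)`, `V_n = (1/2n)(Φ_n'/Φ_n − n²/x)`
(pure algebra; or analytically via `PeriodPair`), fibrewise Newton–Leibniz (rule 3): the constants `W̃_n` at the
cut points telescope to zero (`W̃_n(T) = 0` by oddness); (iv) dlog unfolding of `∫V_n dx` along the real/conjugate
branches of `Φ_n` (floor rule-2 technology, `CubicBranchData`); (v) inner regularisation `[rI] + [H] ≡ [log √(x/e₁)]`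
is the landed `stub_rIReduction`. Why it might fail as typed: an integrality slip in the multiplicities
`(4, 4n², 2μ, μ²−n²+1, 4(n²−1))` (the value identity is verified numerically, the primitive integer chain is the
claim); the semialgebraic bookkeeping of `n²` cells is uniform in `n` but heavy. [cite: Lawden1989, §6.8] -/
theorem stub_sheetTransfer : SheetTransfer := by
  sorry

/-- **Stub 2 (M): the complete regularised triangle.**  Proof plan: `H_∞` is absolutely convergent
(`|h|/√f ∈ L¹(e₁,∞)`, bounded inner integral against `1/√f ∈ L¹`); shuffle `[H_∞] + [H_∞ᵗ] = ½[rP]` (rules 1: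
Fubini + domain additivity, diagonal null); the 2-torsion translation `τ_T : x ↦ x(P + T)` maps `(e₁,∞)` to itself
reversing order, so rule 2 by `τ_T × τ_T` carries `[H_∞ᵗ]` to `[H_∞]` plus the translation-cocycle boundary terms of
the floor (`StubTranslationCalculus` with the torsion point `T`), which unfold to logarithms; expected value
`4H_∞ − ω₁η₁-value = ½·log(|ψ₃(e₁)|/e₁⁴)` (verified numerically to `2·10⁻¹⁵`). Why it might fail as typed: only
if the primitive coefficient pair `(4, −1)` needed doubling (then restate with `(8, −2)` and odd `n` only).
[cite: Lawden1989, §6.8] -/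
theorem stub_completeTriangle : CompleteTriangle := by
  sorry

/-- **Stub 3 (residual, conjecture-grade).** [cite: KontsevichZagier2001, §1.2] -/
theorem stub_distributionComplete : DistributionSectorComplete := by
  sorry

/-! ### The degenerate member from the floor (no stub) -/

/-- The discriminant of the Weierstrass model `Y² = X³ − (g₂/4)X − g₃/4` is `g₂³ − 27g₃²`. [folklore] -/
theorem curve_Δ (g₂ g₃ : ℝ) :
    (⟨0, 0, 0, -g₂ / 4, -g₃ / 4⟩ : WeierstrassCurve ℝ).toAffine.Δ = g₂ ^ 3 - 27 * g₃ ^ 2 := by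
  simp only [WeierstrassCurve.Δ, WeierstrassCurve.b₂, WeierstrassCurve.b₄, WeierstrassCurve.b₆,
    WeierstrassCurve.b₈]
  ring

/-- A real point `(x, y/2)` with `y² = 4x³ − g₂x − g₃`, `Δ ≠ 0`, is nonsingular. [folklore] -/
theorem curve_nonsingular {g₂ g₃ x y : ℝ} (hΔ : g₂ ^ 3 - 27 * g₃ ^ 2 ≠ 0) (f : ℝ → ℝ)
    (hf : ∀ x, f x = 4 * x ^ 3 - g₂ * x - g₃) (hy : y ^ 2 = f x) :
    (⟨0, 0, 0, -g₂ / 4, -g₃ / 4⟩ : WeierstrassCurve ℝ).toAffine.Nonsingular x (y / 2) := by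
  refine (WeierstrassCurve.Affine.equation_iff_nonsingular_of_Δ_ne_zero ?_).mp ?_
  · rw [curve_Δ]; exact hΔ
  · rw [WeierstrassCurve.Affine.equation_iff]
    have h := hy
    rw [hf] at h
    dsimp only
    linear_combination (1 / 4 : ℝ) * h

set_option maxHeartbeats 1600000 in
/-- **DEGENERATE MEMBER `regular = false` = the floor `stub_assembly` times `−g²`** (verbatim copy of the
witness file `Lines/NeronDistribution_special.lean`; no stub used). [cite: KontsevichZagier2001, §1.2] -/
theorem neronDistributionMember_false : NeronDistributionMember false := by
  intro g₂ g₃ e₁ xP yP xQ yQ B N a n ε k μ c f hf hΔ he₁ he₁pos hfpos hxP hyP hord htor hn hxQ hyQ hmul hε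
    hsheet hμ rIP rIQ rRQ rP rB hIPd hIPi hIQd hIQi hRQd hRQi hPd hPi hB1 hBd hBi hval
  have hxQe : xQ = e₁ := by simpa using hxQ
  subst hxQe
  have hyQ0 : yQ = 0 := by
    rw [he₁] at hyQ
    exact pow_eq_zero_iff (two_ne_zero) |>.mp hyQ
  subst hyQ0
  -- (1) the points `P` and `T = (e₁, 0)`; `n • P = T`, `2 • T = 0`, so `P` has finite order `N ≥ 3`
  have hnsP := curve_nonsingular hΔ f hf hyP
  have hnsT : (⟨0, 0, 0, -g₂ / 4, -g₃ / 4⟩ : WeierstrassCurve ℝ).toAffine.Nonsingular xQ ((0 : ℝ) / 2) :=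
    curve_nonsingular hΔ f hf (by rw [he₁]; ring)
  have hPT := hmul hnsP hnsT
  have h2T : (2 : ℕ) • WeierstrassCurve.Affine.Point.some xQ ((0 : ℝ) / 2) hnsT = 0 := by
    rw [two_nsmul]
    exact WeierstrassCurve.Affine.Point.add_self_of_Y_eq (by simp [WeierstrassCurve.Affine.negY])
  have h2nP : (2 * n) • WeierstrassCurve.Affine.Point.some xP (yP / 2) hnsP = 0 := by
    rw [mul_nsmul', hPT, h2T]
  have hN : addOrderOf (WeierstrassCurve.Affine.Point.some xP (yP / 2) hnsP) = N := hord hnsP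
  have hNpos : 0 < N := by
    rw [← hN]
    exact (isOfFinAddOrder_iff_nsmul_eq_zero.mpr ⟨2 * n, by omega, h2nP⟩).addOrderOf_pos
  have hN1 : N ≠ 1 := by
    intro h1
    rw [h1, AddMonoid.addOrderOf_eq_one_iff] at hN
    exact WeierstrassCurve.Affine.Point.some_ne_zero hnsP hN
  have hN2 : N ≠ 2 := by
    intro h2
    have h2P : (2 : ℕ) • WeierstrassCurve.Affine.Point.some xP (yP / 2) hnsP = 0 := by
      have h0 := addOrderOf_nsmul_eq_zero (WeierstrassCurve.Affine.Point.some xP (yP / 2) hnsP)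
      rwa [hN, h2] at h0
    rw [two_nsmul, add_eq_zero_iff_eq_neg, WeierstrassCurve.Affine.Point.neg_some] at h2P
    have hy : yP / 2 = (⟨0, 0, 0, -g₂ / 4, -g₃ / 4⟩ : WeierstrassCurve ℝ).toAffine.negY xP (yP / 2) := by
      simpa using h2P
    simp only [WeierstrassCurve.Affine.negY] at hy
    have hy0 : yP = 0 := by linarith
    have : f xP = 0 := by rw [← hyP, hy0]; ring
    exact (hfpos xP hxP).ne' this
  have hN3 : 3 ≤ N := by omega
  -- (2) the real dictionary: `0 < U_P < ω/2`
  obtain ⟨ω, X, Y, hω, hωint, -, -, -, -, -, -, -, -, -, -, hsurj, hint, -⟩ :=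
    stub_realDictionary g₂ g₃ xQ f hf hΔ he₁ hfpos
  set Ω : ℝ := ∫ x in Set.Ioi xQ, (Real.sqrt (f x))⁻¹ with hΩ
  set UP : ℝ := ∫ x in Set.Ioi xP, (Real.sqrt (f x))⁻¹ with hUP
  have hΩω : ω = 2 * Ω := hωint
  have hΩpos : 0 < Ω := by linarith
  obtain ⟨u, hu, hXu⟩ := hsurj xP hxP
  have hUPu : UP = u := by
    have h1 := hint u ⟨hu.1, hu.2.le⟩
    rw [hXu] at h1
    exact h1
  have hUPpos : 0 < UP := by rw [hUPu]; exact hu.1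
  have hUPlt : UP < Ω := by rw [hUPu]; linarith [hu.2]
  -- (3) `0 < a`, `2a < N`, and the integer relation `N(1 − 2k) = 2εna`
  have hNr : (0 : ℝ) < N := by exact_mod_cast hNpos
  have ha : 0 < a := by
    rcases Nat.eq_zero_or_pos a with h0 | h0
    · exfalso
      rw [h0] at htor
      have : (N : ℝ) * UP = 0 := by rw [htor]; push_cast; ring
      rcases mul_eq_zero.mp this with h | h
      · linarith
      · linarith
    · exact h0
  have haN : 2 * a < N := by
    have h1 : (a : ℝ) * (2 * Ω) < N * Ω := by
      rw [← htor]
      exact mul_lt_mul_of_pos_left hUPlt hNr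
    have h2 : ((2 * a : ℕ) : ℝ) < N := by
      push_cast
      nlinarith
    exact_mod_cast h2
  have hrel : (N : ℤ) * (1 - 2 * k) = 2 * ε * n * a := by
    have h1 : (N : ℝ) * Ω = ε * n * ((N : ℝ) * UP) + 2 * k * ((N : ℝ) * Ω) := by
      linear_combination (N : ℝ) * hsheet
    rw [htor] at h1
    have h2 : ((N : ℝ) * (1 - 2 * k) - 2 * ε * n * a) * Ω = 0 := by linear_combination h1
    rcases mul_eq_zero.mp h2 with h3 | h3
    · exact_mod_cast (sub_eq_zero.mp h3)
    · exact absurd h3 hΩpos.ne'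
  -- (4) `p/q = (N − 2a)/(2N)` in lowest terms; `2n = g q`, `μ = −ε g p`
  set g₀ : ℕ := Nat.gcd (N - 2 * a) (2 * N) with hg₀
  have hg₀pos : 0 < g₀ := Nat.gcd_pos_of_pos_right _ (by omega)
  set p : ℕ := (N - 2 * a) / g₀ with hp
  set q : ℕ := (2 * N) / g₀ with hq
  have hcop : Nat.Coprime p q := Nat.coprime_div_gcd_div_gcd hg₀pos
  have hp' : g₀ * p = N - 2 * a := Nat.mul_div_cancel' (Nat.gcd_dvd_left _ _)
  have hq' : g₀ * q = 2 * N := Nat.mul_div_cancel' (Nat.gcd_dvd_right _ _)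
  have hqpos : 0 < q := by
    rcases Nat.eq_zero_or_pos q with h0 | h0
    · rw [h0, mul_zero] at hq'; omega
    · exact h0
  have hpz : (g₀ : ℤ) * p = (N : ℤ) - 2 * (a : ℤ) := by
    have := congrArg (fun t : ℕ => (t : ℤ)) hp'
    push_cast [Nat.cast_sub (by omega : 2 * a ≤ N)] at this
    linarith
  have hqz : (g₀ : ℤ) * q = 2 * (N : ℤ) := by exact_mod_cast hq'
  have hqN : (q : ℤ) * ((N : ℤ) - 2 * (a : ℤ)) = (p : ℤ) * (2 * (N : ℤ)) := by
    rw [← hpz, ← hqz]; ring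
  -- `μ q = −2 ε n p`
  have hε2 : ε ^ 2 = 1 := by rcases hε with h | h <;> simp [h]
  have hμq : μ * (q : ℤ) = -(2 * ε * (n : ℤ) * p) := by
    -- multiply `μ = 1 − εn − 2k` by `N q = ... `; use `N(1−2k) = 2εna`, `g₀ p = N − 2a`, `g₀ q = 2N`
    have h1 : μ * (q : ℤ) * (g₀ : ℤ) = -(2 * ε * (n : ℤ) * p) * (g₀ : ℤ) := by
      have e1 : μ * (q : ℤ) * (g₀ : ℤ) = μ * (2 * N) := by rw [← hqz]; ring
      have e2 : -(2 * ε * (n : ℤ) * ↑p) * (g₀ : ℤ) = -(2 * ε * n) * ((N : ℤ) - 2 * a) := by rw [← hpz]; ring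
      rw [e1, e2, hμ]
      linear_combination (2 : ℤ) * hrel
    have hg₀z : (g₀ : ℤ) ≠ 0 := by exact_mod_cast hg₀pos.ne'
    exact mul_right_cancel₀ hg₀z h1
  -- `q ∣ 2n`
  have hqdvd : (q : ℤ) ∣ 2 * (n : ℤ) := by
    have hc : IsCoprime (q : ℤ) (p : ℤ) := Nat.isCoprime_iff_coprime.mpr hcop.symm
    have h1 : (q : ℤ) ∣ (p : ℤ) * (2 * ε * n) := ⟨-μ, by linear_combination hμq⟩
    have h2 : (q : ℤ) ∣ 2 * ε * n := hc.dvd_of_dvd_mul_left h1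
    rcases hε with h | h
    · simpa [h] using h2
    · have : (q : ℤ) ∣ -(2 * ε * n) := (dvd_neg).mpr h2
      simpa [h] using this
  obtain ⟨g, hg⟩ := hqdvd
  -- `μ = −ε g p`
  have hμg : μ = -(ε * g * p) := by
    have hqz0 : (q : ℤ) ≠ 0 := by exact_mod_cast hqpos.ne'
    have h1 : μ * (q : ℤ) = -(ε * g * p) * (q : ℤ) := by rw [hμq]; linear_combination (-ε * (p : ℤ)) * hg
    exact mul_right_cancel₀ hqz0 h1
  have h4n : ((4 * n ^ 2 : ℕ) : ℤ) = g ^ 2 * (q : ℤ) ^ 2 := by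
    push_cast; linear_combination (2 * (n : ℤ) + (q : ℤ) * g) * hg
  have hμ2 : μ ^ 2 = g ^ 2 * (p : ℤ) ^ 2 := by
    rw [hμg]; linear_combination (g ^ 2 * (p : ℤ) ^ 2) * hε2
  -- (5) the empty representations `rI_Q`, `rR_Q` are relations
  have hIQrel : KZ.of rIQ ∈ KZ.relations :=
    KZ.of_mem_relations_of_eqOn_zero rIQ fun t ht => by
      rw [hIQd] at ht
      obtain ⟨h1, h2, h3⟩ := ht
      linarith
  have hRQrel : KZ.of rRQ ∈ KZ.relations :=
    KZ.of_mem_relations_of_eqOn_zero rRQ fun t ht => by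
      rw [hRQd] at ht
      obtain ⟨h1, h2, h3⟩ := ht
      linarith
  -- (6) the floor
  obtain ⟨c₀, B₀, rB₀, hB₀1, hB₀alg, hrB₀d, hrB₀i, hmem⟩ := stub_assembly g₂ g₃ xQ xP yP N a p q f hf hΔ he₁
    he₁pos hfpos hxP hyP hN3 ha haN hord htor hcop hqN rIP rP hIPd hIPi hPd hPi
  -- (7) values: soundness of the calculus on the floor relation and on the empty reps; exchange of carriers
  have hBalg : IsAlgebraic ℚ B :=
    (isAlgebraic_endpoints_of_isSemialgebraic_Ioo hB1 (hBd ▸ rB.isSemialgebraic_domain)).2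
  have hv₀ : rB₀.value = Real.log B₀ := logRep_value hB₀1.le rB₀ hrB₀d hrB₀i
  have hv : rB.value = Real.log B := logRep_value hB1.le rB hBd hBi
  have hvIQ : rIQ.value = 0 := by
    have h1 := KZ.relations_le_ker_eval_holds hIQrel
    rw [AddMonoidHom.mem_ker] at h1
    simpa only [KZ.eval_of] using h1
  have hvRQ : rRQ.value = 0 := by
    have h1 := KZ.relations_le_ker_eval_holds hRQrel
    rw [AddMonoidHom.mem_ker] at h1
    simpa only [KZ.eval_of] using h1
  have e0 : (q : ℝ) ^ 2 * rIP.value + (p : ℝ) ^ 2 * rP.value - c₀ * Real.log B₀ = 0 := by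
    have h1 := KZ.relations_le_ker_eval_holds hmem
    rw [AddMonoidHom.mem_ker] at h1
    simpa only [map_add, map_sub, map_zsmul, KZ.eval_of, zsmul_eq_mul, Int.cast_pow, Int.cast_natCast,
      hv₀] using h1
  have h4nr : (4 : ℝ) * (n : ℝ) ^ 2 = (g : ℝ) ^ 2 * (q : ℝ) ^ 2 := by
    have := congrArg (fun t : ℤ => (t : ℝ)) h4n
    push_cast at this
    linarith
  have hμ2r : (μ : ℝ) ^ 2 = (g : ℝ) ^ 2 * (p : ℝ) ^ 2 := by exact_mod_cast hμ2
  have hlog : (c : ℝ) * Real.log B + (g : ℝ) ^ 2 * c₀ * Real.log B₀ = 0 := by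
    rw [hvIQ, hvRQ, hv, h4nr, hμ2r] at hval
    have : (c : ℝ) * Real.log B = -(g : ℝ) ^ 2 * ((q : ℝ) ^ 2 * rIP.value + (p : ℝ) ^ 2 * rP.value) := by
      rw [← hval]; ring
    rw [this]
    linear_combination (-(g : ℝ) ^ 2) * e0
  have hsum : ∑ i : Fin 2, (![c, g ^ 2 * c₀] i) • KZ.of ((![rB, rB₀]) i) = c • KZ.of rB + (g ^ 2 * c₀) • KZ.of rB₀ := by
    rw [Fin.sum_univ_two]
    rfl
  have hcar : c • KZ.of rB + (g ^ 2 * c₀) • KZ.of rB₀ ∈ KZ.relations := by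
    rw [← hsum]
    refine interval_log_relation_mem_relations 2 (fun _ => (1 : ℝ)) ![B, B₀] ![c, g ^ 2 * c₀] ![rB, rB₀]
      (fun _ => one_pos) (Fin.forall_fin_two.2 ⟨hB1.le, hB₀1.le⟩) (fun _ => isAlgebraic_one)
      (Fin.forall_fin_two.2 ⟨hBalg, hB₀alg⟩)
      (Fin.forall_fin_two.2
        ⟨⟨hBd, fun t ht => show rB.integrand t = 1 / t 0 by rw [hBi ht, one_div]⟩,
         ⟨hrB₀d, fun t ht => show rB₀.integrand t = 1 / t 0 by rw [hrB₀i ht, one_div]⟩⟩) ?_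
    rw [Fin.sum_univ_two]
    simp only [Matrix.cons_val_zero, Matrix.cons_val_one, div_one, Int.cast_mul, Int.cast_pow]
    linear_combination hlog
  -- (8) assemble: `D − c[rB] = 4[rI_Q] + 2μ[rR_Q] − g²·(floor element) − (carrier exchange)`
  have e : (4 : ℤ) • KZ.of rIQ - ((4 * n ^ 2 : ℕ) : ℤ) • KZ.of rIP + (2 * μ) • KZ.of rRQ - (μ ^ 2) • KZ.of rP
        - c • KZ.of rB
      = (4 : ℤ) • KZ.of rIQ + (2 * μ) • KZ.of rRQ
        - (g ^ 2) • (((q : ℤ) ^ 2) • KZ.of rIP + ((p : ℤ) ^ 2) • KZ.of rP - c₀ • KZ.of rB₀)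
        - (c • KZ.of rB + (g ^ 2 * c₀) • KZ.of rB₀) := by
    rw [h4n, hμ2, smul_sub, smul_add, smul_smul, smul_smul, smul_smul, mul_smul (g ^ 2) c₀]
    abel
  rw [e]
  refine sub_mem (sub_mem (add_mem (AddSubgroup.zsmul_mem _ hIQrel _) (AddSubgroup.zsmul_mem _ hRQrel _))
    (AddSubgroup.zsmul_mem _ hmem _)) hcar


/-! ### The regular member from stubs 1–2 -/

set_option maxHeartbeats 1600000 in
/-- **REGULAR MEMBER `regular = true` from the two stubs**: stub 2 supplies the complete triangle `H_∞` with
`4[H_∞] − [rP] ≡ c₂[rB₂]`, stub 1 gives `4[rI_Q] − 4n²[rI_P] + 2μ[rR_Q] − (μ²−n²+1)[rP] − 4(n²−1)[H_∞] ≡ c₁[rB₁]`;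
adding `(n²−1)·(stub 2)` yields the distribution element `≡ c₁[rB₁] + (n²−1)c₂[rB₂]`, and the carriers are
exchanged for the given one by soundness (`KZ.relations_le_ker_eval_holds`) + the value hypothesis + the landed
exact log relation `interval_log_relation_mem_relations`. [cite: KontsevichZagier2001, §1.2] -/
theorem neronDistributionMember_true_of (h₁ : SheetTransfer) (h₂ : CompleteTriangle) :
    NeronDistributionMember true := by
  intro g₂ g₃ e₁ xP yP xQ yQ B N a n ε k μ c f hf hΔ he₁ he₁pos hfpos hxP hyP hord htor hn hxQ hyQ hmul hε
    hsheet hμ rIP rIQ rRQ rP rB hIPd hIPi hIQd hIQi hRQd hRQi hPd hPi hB1 hBd hBi hval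
  have hxQ' : e₁ < xQ := by simpa using hxQ
  obtain ⟨Hinf, c₂, B₂, rB₂, hHd, hHi, hB₂1, hB₂alg, hrB₂d, hrB₂i, hmem₂⟩ :=
    h₂ g₂ g₃ e₁ f hf hΔ he₁ he₁pos hfpos rP hPd hPi
  obtain ⟨c₁, B₁, rB₁, hB₁1, hB₁alg, hrB₁d, hrB₁i, hmem₁⟩ :=
    h₁ g₂ g₃ e₁ xP yP xQ yQ n ε k μ f hf hΔ he₁ he₁pos hfpos hxP hyP hn hxQ' hyQ hmul hε hsheet hμ rIP rIQ rRQ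
      rP Hinf hIPd hIPi hIQd hIQi hRQd hRQi hPd hPi hHd hHi
  -- values
  have hBalg : IsAlgebraic ℚ B :=
    (isAlgebraic_endpoints_of_isSemialgebraic_Ioo hB1 (hBd ▸ rB.isSemialgebraic_domain)).2
  have hv : rB.value = Real.log B := logRep_value hB1.le rB hBd hBi
  have hv₁ : rB₁.value = Real.log B₁ := logRep_value hB₁1.le rB₁ hrB₁d hrB₁i
  have hv₂ : rB₂.value = Real.log B₂ := logRep_value hB₂1.le rB₂ hrB₂d hrB₂i
  have e1 : 4 * rIQ.value - 4 * (n : ℝ) ^ 2 * rIP.value + 2 * (μ : ℝ) * rRQ.value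
      - ((μ : ℝ) ^ 2 - (n : ℝ) ^ 2 + 1) * rP.value - 4 * ((n : ℝ) ^ 2 - 1) * Hinf.value
      - c₁ * Real.log B₁ = 0 := by
    have h1 := KZ.relations_le_ker_eval_holds hmem₁
    rw [AddMonoidHom.mem_ker] at h1
    simp only [map_add, map_sub, map_zsmul, KZ.eval_of, zsmul_eq_mul, Int.cast_pow, Int.cast_natCast,
      Int.cast_mul, Int.cast_ofNat, Int.cast_sub, Int.cast_add, Int.cast_one, Nat.cast_mul, Nat.cast_pow,
      Nat.cast_ofNat, hv₁] at h1
    linear_combination h1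
  have e2 : 4 * Hinf.value - rP.value - c₂ * Real.log B₂ = 0 := by
    have h1 := KZ.relations_le_ker_eval_holds hmem₂
    rw [AddMonoidHom.mem_ker] at h1
    simp only [map_sub, map_zsmul, KZ.eval_of, zsmul_eq_mul, Int.cast_ofNat, hv₂] at h1
    linear_combination h1
  have hlog : (c : ℝ) * Real.log B - c₁ * Real.log B₁ - ((n : ℝ) ^ 2 - 1) * c₂ * Real.log B₂ = 0 := by
    rw [hv] at hval
    linear_combination -hval + e1 + ((n : ℝ) ^ 2 - 1) * e2
  -- carrier exchange
  have hsum : ∑ i : Fin 3, (![c, -c₁, -(((n : ℤ) ^ 2 - 1) * c₂)] i) • KZ.of ((![rB, rB₁, rB₂]) i)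
      = c • KZ.of rB + (-c₁) • KZ.of rB₁ + (-(((n : ℤ) ^ 2 - 1) * c₂)) • KZ.of rB₂ := by
    rw [Fin.sum_univ_three]
    rfl
  have hcar : c • KZ.of rB + (-c₁) • KZ.of rB₁ + (-(((n : ℤ) ^ 2 - 1) * c₂)) • KZ.of rB₂ ∈ KZ.relations := by
    rw [← hsum]
    refine interval_log_relation_mem_relations 3 (fun _ => (1 : ℝ)) ![B, B₁, B₂]
      ![c, -c₁, -(((n : ℤ) ^ 2 - 1) * c₂)] ![rB, rB₁, rB₂] (fun _ => one_pos) ?_ (fun _ => isAlgebraic_one) ?_ ?_ ?_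
    · intro i; fin_cases i <;> simp [hB1.le, hB₁1.le, hB₂1.le]
    · intro i; fin_cases i <;> simp [hBalg, hB₁alg, hB₂alg]
    · intro i
      fin_cases i
      · exact ⟨hBd, fun t ht => show rB.integrand t = 1 / t 0 by rw [hBi ht, one_div]⟩
      · exact ⟨hrB₁d, fun t ht => show rB₁.integrand t = 1 / t 0 by rw [hrB₁i ht, one_div]⟩
      · exact ⟨hrB₂d, fun t ht => show rB₂.integrand t = 1 / t 0 by rw [hrB₂i ht, one_div]⟩
    · rw [Fin.sum_univ_three]
      simp only [Matrix.cons_val_zero, Matrix.cons_val_one, Matrix.cons_val_two, Matrix.tail_cons,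
        Matrix.head_cons, div_one, Int.cast_neg, Int.cast_mul, Int.cast_sub, Int.cast_pow, Int.cast_natCast,
        Int.cast_one]
      linear_combination hlog
  -- assemble
  have e : (4 : ℤ) • KZ.of rIQ - ((4 * n ^ 2 : ℕ) : ℤ) • KZ.of rIP + (2 * μ) • KZ.of rRQ - (μ ^ 2) • KZ.of rP
        - c • KZ.of rB
      = ((4 : ℤ) • KZ.of rIQ - ((4 * n ^ 2 : ℕ) : ℤ) • KZ.of rIP + (2 * μ) • KZ.of rRQ
          - (μ ^ 2 - n ^ 2 + 1) • KZ.of rP - (4 * ((n : ℤ) ^ 2 - 1)) • KZ.of Hinf - c₁ • KZ.of rB₁)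
        + ((n : ℤ) ^ 2 - 1) • ((4 : ℤ) • KZ.of Hinf - KZ.of rP - c₂ • KZ.of rB₂)
        - (c • KZ.of rB + (-c₁) • KZ.of rB₁ + (-(((n : ℤ) ^ 2 - 1) * c₂)) • KZ.of rB₂) := by
    module
  rw [e]
  exact sub_mem (add_mem hmem₁ (AddSubgroup.zsmul_mem _ hmem₂ _)) hcar

/-! ### The rung from the stubs; the residual side; the crux by name -/

/-- **`NeronDistribution_of`: the RUNG from stubs 1–2** (closed term, no `sorry` of its own; the degenerate member
is the floor). -/
theorem NeronDistribution_of : SheetTransfer → CompleteTriangle → NeronDistribution := by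
  intro h₁ h₂ regular
  cases regular
  · exact neronDistributionMember_false
  · exact neronDistributionMember_true_of h₁ h₂

/-- The rung itself from the registered stubs (closed term). -/
theorem neronDistribution_holds : NeronDistribution := NeronDistribution_of stub_sheetTransfer stub_completeTriangle

/-- Instantiation (F3 shape): each member from the rung. -/
theorem member_of_rung (h : NeronDistribution) (regular : Bool) : NeronDistributionMember regular := h regular

/-- The rung folds the tied distribution elements into the moves: `closure DistributionTied ≤ KZ.relations`.
[cite: KontsevichZagier2001, §1.2] -/
theorem closure_distributionTied_le_relations (h : NeronDistribution) :
    AddSubgroup.closure DistributionTied ≤ Literature.NumberTheory.Transcendental.KZ.relations := by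
  refine (AddSubgroup.closure_le _).mpr ?_
  rintro d ⟨regular, g₂, g₃, e₁, xP, yP, xQ, yQ, B, N, a, n, ε, k, μ, c, f, rIP, rIQ, rRQ, rP, rB, hf, hΔ, he₁,
    he₁pos, hfpos, hxP, hyP, hord, htor, hn, hxQ, hyQ, hmul, hε, hsheet, hμ, hIPd, hIPi, hIQd, hIQi, hRQd, hRQi,
    hPd, hPi, hB1, hBd, hBi, hval, rfl⟩
  exact h regular g₂ g₃ e₁ xP yP xQ yQ B N a n ε k μ c f hf hΔ he₁ he₁pos hfpos hxP hyP hord htor hn hxQ hyQ hmul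
    hε hsheet hμ rIP rIQ rRQ rP rB hIPd hIPi hIQd hIQi hRQd hRQi hPd hPi hB1 hBd hBi hval

/-- The residual is a consequence of the crux (monotonicity of `⊔`): stub 3 is WEAKER than the crux. [folklore] -/
theorem distributionSectorComplete_of_torsionSectorComplete (h : TorsionSectorComplete) :
    DistributionSectorComplete :=
  fun _ _ r r' hr hr' hv => AddSubgroup.mem_sup_left (h r r' hr hr' hv)

/-- The residual also follows from the summit directly. [folklore] -/
theorem distributionSectorComplete_of_kontsevichZagierPeriods (h : _root_.KontsevichZagierPeriods) :
    DistributionSectorComplete :=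
  distributionSectorComplete_of_torsionSectorComplete
    (Summit.KontsevichZagierPeriods.TorsionLogs.TorsionSectorComplete.of_summit h)

/-- **`TorsionSectorComplete` from the three stubs** (closed term; `sorry` only through `stub_sheetTransfer`,
`stub_completeTriangle`, `stub_distributionComplete`): the rung folds `closure DistributionTied` into the moves,
so the residual's enlarged sector is already `≤ relations ⊔ closure TorsionTied`. [cite: KontsevichZagier2001, §1.2] -/
theorem TorsionSectorComplete_of :
    Summit.KontsevichZagierPeriods.KontsevichZagierPeriods.Theses.TorsionLogs.TorsionSectorComplete := by
  suffices key : SheetTransfer → CompleteTriangle → DistributionSectorComplete →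
      Summit.KontsevichZagierPeriods.KontsevichZagierPeriods.Theses.TorsionLogs.TorsionSectorComplete from
    key stub_sheetTransfer stub_completeTriangle stub_distributionComplete
  intro h₁ h₂ h₃ n m r r' hr hr' hv
  have hR : NeronDistribution := NeronDistribution_of h₁ h₂
  have hle : (KZ.relations ⊔ AddSubgroup.closure TorsionTied) ⊔ AddSubgroup.closure DistributionTied ≤
      KZ.relations ⊔ AddSubgroup.closure TorsionTied :=
    sup_le le_rfl ((closure_distributionTied_le_relations hR).trans le_sup_left)
  exact hle (h₃ r r' hr hr' hv)

/-! ### On-path (F4): the summit implies the rung -/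

/-- **ON-PATH (F4)** (verbatim from `Lines/NeronDistribution_onpath.lean`): the summit in kernel form applied to the
tied element, whose evaluation vanishes by the value hypothesis. [cite: KontsevichZagier2001, §1.2] -/
theorem neronDistribution_of_kontsevichZagierPeriods (h : _root_.KontsevichZagierPeriods) : NeronDistribution := by
  intro regular g₂ g₃ e₁ xP yP xQ yQ B N a n ε k μ c f hf hΔ he₁ he₁pos hfpos hxP hyP hord htor hn hxQ hyQ hmul hε
    hsheet hμ rIP rIQ rRQ rP rB hIPd hIPi hIQd hIQi hRQd hRQi hPd hPi hB1 hBd hBi hval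
  have hK : KZKernelConjecture := kzKernelConjecture_iff_isRational.mpr (KontsevichZagierPeriods_iff.mp h)
  refine hK _ ?_
  simp only [map_sub, map_add, map_zsmul, KZ.eval_of, zsmul_eq_mul, Int.cast_pow, Int.cast_natCast,
    Int.cast_mul, Int.cast_ofNat, Nat.cast_mul, Nat.cast_pow, Nat.cast_ofNat]
  linear_combination hval

/-- The residual is implied by the rung's target: informational square `summit ⇒ crux ⇒ residual`. [folklore] -/
example (h : _root_.KontsevichZagierPeriods) : TorsionSectorComplete ∧ NeronDistribution ∧ DistributionSectorComplete :=
  ⟨Summit.KontsevichZagierPeriods.TorsionLogs.TorsionSectorComplete.of_summit h,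
   neronDistribution_of_kontsevichZagierPeriods h, distributionSectorComplete_of_kontsevichZagierPeriods h⟩

end Summit.KontsevichZagierPeriods.KontsevichZagierPeriods.Cruxes.TorsionSectorComplete.NeronDistribution
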